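import Summits.QuantumFields.YangMills.Theorems.RationalShortRootRigidityHyperplaneVanishing
import Summits.QuantumFields.YangMills.Theorems.RationalShortRootRigidityStieltjesTransfer
import HarnessLib

/-!
# `RationalShortRootRigidity` — Step 1 helper (m12b): no real linear form divides the reduced denominator

Helper lemma INSIDE the paper proof of crux `stmt-QuantumFields-23124` (`F4SubCurvatureDoor.RationalShortRootRigidity`, LINE g15-A
of planner ym-idea-3; Step 1 = `stub_reduce`; free-hands MENU IV, item (m12b), statement typed in HOME l15/Helpers23124c.lean as
`Helpers.LinearFactorObstruction` — proved here DEF-FREE, with `FullDeg` / `AxisStieltjes` unfolded to their bodies exactly as in the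
crux text):

**Lemma** (`linearFactorObstruction`).  If `(N₀, D₀)` is a relatively prime pair in `ℝ[p₀, q]`, `D₀` has full `p₀`-degree, and
`N₀/D₀` is axis-Stieltjes for every `q ≠ 0`, then no real linear form `ℓ = Σ aᵢ Xᵢ` (`a ≠ 0`) divides `D₀`.

Proof.  Suppose `ℓ ∣ D₀`.
* If `a₀ ≠ 0`: on the hyperplane `{ℓ = 0}` every point with `q ≠ 0` is `(t*(q), q)`; there `D₀ = 0`, the Stieltjes factor
  `c(t²) + Σ rⱼ/(t² + ωⱼ²)` is finite (`ωⱼ > 0`), so `N₀ = 0`; the only hyperplane point with `q = 0` is the origin, reached by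
  continuity along `ε ↦ (−a₁ε/a₀, ε, 0, 0)`.  Hence `N₀` vanishes on `{ℓ = 0}`, so `ℓ ∣ N₀` (tree `hyperplaneVanishingDivides`, m12c),
  and relative primality makes `ℓ` a unit — absurd (`ℓ(0) = 0`).
* If `a₀ = 0`: pick `q ≠ 0` orthogonal to `(a₁, a₂, a₃)`; then `D₀(t, q) = 0` for every `t`, contradicting full `p₀`-degree
  (tree `fibre_ne_zero_of_fullDeg`, m11 file).

Imports the two landed helper modules (m12c, m11); THEOREMS ONLY; no `sorry`.  Nothing about the crux 23124, the route's rung (R2d) or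
the Yang–Mills mass gap is proved here.  Width seat `ym-line-sfw-p2-w2` g23 (cell ym-idea-1; free hands), `--supports stmt-QuantumFields-23124`.
-/

set_option autoImplicit false

namespace Summit.QuantumFields.YangMills.Theorems.RationalShortRootRigidity

open scoped BigOperators Polynomial

/-- A real linear form is not a unit of `ℝ[p₀, q]` (it vanishes at the origin). [folklore] -/
theorem not_isUnit_linearForm (a : Fin 4 → ℝ) :
    ¬ IsUnit (∑ i, MvPolynomial.C (a i) * MvPolynomial.X i : MvPolynomial (Fin 4) ℝ) := by
  intro hu
  obtain ⟨m, hm⟩ := hu.exists_right_inv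
  have h0 : MvPolynomial.eval (0 : Fin 4 → ℝ) (∑ i, MvPolynomial.C (a i) * MvPolynomial.X i) = 0 := by
    simp [map_sum]
  have h1 := congrArg (MvPolynomial.eval (0 : Fin 4 → ℝ)) hm
  rw [map_mul, h0, zero_mul, map_one] at h1
  exact zero_ne_one h1

/-- ★ **(m12b) no real linear factor of the reduced denominator** (`Helpers.LinearFactorObstruction`, body verbatim with `FullDeg` /
`AxisStieltjes` unfolded as in the crux text). [folklore] -/
theorem linearFactorObstruction :
    ∀ N₀ D₀ : MvPolynomial (Fin 4) ℝ, IsRelPrime N₀ D₀ →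
      MvPolynomial.coeff (Finsupp.single 0 D₀.totalDegree) D₀ ≠ 0 → 0 < D₀.totalDegree →
      (∀ q : Fin 3 → ℝ, q ≠ 0 → ∃ (k : ℕ) (ω r : Fin k → ℝ) (c : Polynomial ℝ),
        (∀ j, 0 < ω j) ∧ (∀ j, 0 ≤ r j) ∧
        ∀ t : ℝ, MvPolynomial.eval (Fin.cons t q) N₀ =
          MvPolynomial.eval (Fin.cons t q) D₀ * (c.eval (t ^ 2) + ∑ j, r j / (t ^ 2 + ω j ^ 2))) →
      ∀ a : Fin 4 → ℝ, a ≠ 0 → ¬ ((∑ i, MvPolynomial.C (a i) * MvPolynomial.X i) ∣ D₀) := by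
  intro N₀ D₀ hrel hfull _hpos hAS a ha hdvd
  set ℓ : MvPolynomial (Fin 4) ℝ := ∑ i, MvPolynomial.C (a i) * MvPolynomial.X i with hℓ
  have hℓeval : ∀ v : Fin 4 → ℝ, MvPolynomial.eval v ℓ = ∑ i, a i * v i := by
    intro v; simp [hℓ, map_sum]
  -- `D₀` vanishes on the hyperplane
  have hDzero : ∀ v : Fin 4 → ℝ, ∑ i, a i * v i = 0 → MvPolynomial.eval v D₀ = 0 := by
    intro v hv
    obtain ⟨Q, hQ⟩ := hdvd
    rw [hQ, map_mul, hℓeval v, hv, zero_mul]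
  -- the fibre polynomials
  have hfib : ∀ (P : MvPolynomial (Fin 4) ℝ) (q : Fin 3 → ℝ) (t : ℝ),
      (Polynomial.map (MvPolynomial.eval q) (MvPolynomial.finSuccEquiv ℝ 3 P)).eval t =
        MvPolynomial.eval (Fin.cons t q) P :=
    fun P q t => (MvPolynomial.eval_eq_eval_mv_eval' q t P).symm
  have hsum : ∀ (t : ℝ) (q : Fin 3 → ℝ), ∑ i, a i * (Fin.cons t q : Fin 4 → ℝ) i = a 0 * t + ∑ i : Fin 3, a i.succ * q i := by
    intro t q
    rw [Fin.sum_univ_succ]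
    simp
  by_cases ha0 : a 0 = 0
  · -- Case `a₀ = 0`: some spatial coefficient is non-zero; choose `q ≠ 0` orthogonal to `(a₁,a₂,a₃)`
    have hb : ∃ j : Fin 3, a j.succ ≠ 0 := by
      by_contra hnone
      push Not at hnone
      apply ha
      funext i
      refine Fin.cases ?_ (fun j => ?_) i
      · exact ha0
      · exact hnone j
    obtain ⟨j, hj⟩ := hb
    -- an orthogonal non-zero vector
    obtain ⟨q, hq0, hqorth⟩ : ∃ q : Fin 3 → ℝ, q ≠ 0 ∧ ∑ i : Fin 3, a i.succ * q i = 0 := by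
      fin_cases j
      · refine ⟨![a 2, -a 1, 0], ?_, ?_⟩
        · intro h0
          have := congrFun h0 1
          simp at this
          exact hj (by simpa using this)
        · simp [Fin.sum_univ_three]; ring
      · refine ⟨![-a 2, a 1, 0], ?_, ?_⟩
        · intro h0
          have := congrFun h0 0
          simp at this
          exact hj (by simpa using this)
        · simp [Fin.sum_univ_three]; ring
      · refine ⟨![-a 3, 0, a 1], ?_, ?_⟩
        · intro h0
          have := congrFun h0 0
          simp at this
          exact hj (by simpa using this)
        · simp [Fin.sum_univ_three]; ring
    -- the fibre of `D₀` at `q` vanishes identically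
    have hzero : Polynomial.map (MvPolynomial.eval q) (MvPolynomial.finSuccEquiv ℝ 3 D₀) = 0 := by
      apply Polynomial.funext
      intro t
      rw [hfib, Polynomial.eval_zero]
      apply hDzero
      rw [hsum, ha0, zero_mul, zero_add, hqorth]
    exact fibre_ne_zero_of_fullDeg D₀ hfull q hzero
  · -- Case `a₀ ≠ 0`: `N₀` vanishes on the hyperplane, hence `ℓ ∣ N₀`
    have hNq : ∀ (t : ℝ) (q : Fin 3 → ℝ), q ≠ 0 → ∑ i, a i * (Fin.cons t q : Fin 4 → ℝ) i = 0 →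
        MvPolynomial.eval (Fin.cons t q) N₀ = 0 := by
      intro t q hq hv
      obtain ⟨k, ω, r, c, -, -, hid⟩ := hAS q hq
      rw [hid t, hDzero _ hv, zero_mul]
    have hNzero : ∀ v : Fin 4 → ℝ, ∑ i, a i * v i = 0 → MvPolynomial.eval v N₀ = 0 := by
      intro v hv
      -- split `v = Fin.cons t q`
      have hv' : v = Fin.cons (v 0) (Fin.tail v) := (Fin.cons_self_tail v).symm
      by_cases hq : Fin.tail v = 0
      · -- the origin: `a₀ v₀ = 0` forces `v = 0`; reach it by continuity along `ε ↦ (−a₁ε/a₀, ε, 0, 0)`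
        have hv0 : v 0 = 0 := by
          rw [hv', hsum] at hv
          have : ∑ i : Fin 3, a i.succ * Fin.tail v i = 0 := by rw [hq]; simp
          rw [this, add_zero] at hv
          exact (mul_eq_zero.mp hv).resolve_left ha0
        have hvz : v = 0 := by
          rw [hv', hv0, hq]
          funext i; refine Fin.cases ?_ (fun j => ?_) i <;> simp
        -- the curve
        set γ : ℝ → (Fin 4 → ℝ) := fun ε => Fin.cons (-(a 1 * ε / a 0)) ![ε, 0, 0] with hγ
        have hγcont : Continuous γ := by
          refine continuous_pi fun i => ?_
          refine Fin.cases ?_ (fun j => ?_) i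
          · simp only [hγ, Fin.cons_zero]
            fun_prop
          · simp only [hγ, Fin.cons_succ]
            fin_cases j <;> simp <;> fun_prop
        have hγval : ∀ ε : ℝ, ε ≠ 0 → MvPolynomial.eval (γ ε) N₀ = 0 := by
          intro ε hε
          apply hNq
          · intro h0
            have := congrFun h0 0
            simp at this
            exact hε this
          · rw [hsum]
            simp [Fin.sum_univ_three]
            field_simp
            ring
        have hcontF : Continuous fun ε : ℝ => MvPolynomial.eval (γ ε) N₀ :=
          (MvPolynomial.continuous_eval N₀).comp hγcont
        have hγ0 : γ 0 = 0 := by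
          funext i; refine Fin.cases ?_ (fun j => ?_) i
          · simp [hγ]
          · simp only [hγ, Fin.cons_succ, Pi.zero_apply]
            fin_cases j <;> simp
        have hdense : Dense ({0}ᶜ : Set ℝ) := dense_compl_singleton 0
        have hext : (fun ε : ℝ => MvPolynomial.eval (γ ε) N₀) = fun _ => (0 : ℝ) :=
          Continuous.ext_on hdense hcontF continuous_const fun ε hε => hγval ε hε
        have := congrFun hext 0
        simp only [hγ0] at this
        rw [hvz]
        exact this
      · have h := hNq (v 0) (Fin.tail v) hq (by rw [← hv']; exact hv)
        rwa [← hv'] at h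
    have hℓN : ℓ ∣ N₀ := hyperplaneVanishingDivides 4 N₀ a ha hNzero
    exact not_isUnit_linearForm a (hrel hℓN hdvd)

end Summit.QuantumFields.YangMills.Theorems.RationalShortRootRigidity
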